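import Mathlib
import Summits.AtomisticToContinuum.Crystallization.Theorems.GappedShellCensusCleanLimitsHaveWindowsExactShell

/-!
# Exactly layered shells ⇒ exactly layered set, file 1: the integer atlas of the slot models

Crux `GappedShellCensus.CleanLimitsHaveWindows` (stmt-AtomisticToContinuum-15932), line `Sketch`, support for the
registered stub `stub_layeredOfExactShells` (T3a-ii). The two slot models `slotC a' h⁺ h⁻`, `slotH a' h⁺ h⁻`
(`…Defs.lean`) are indexed here by INTEGER CODES `(3x, 3y, ℓ)`: the slot is `(x u + y v) + height(ℓ) e₃` with
`x, y ∈ ⅓ℤ` and level `ℓ ∈ {0, 1, -1}` (heights `0, h⁺, -h⁻`). All finite geometry of the thirteen-point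
clusters is thereby reduced to integer arithmetic (`decide`) plus a handful of real inequalities:

* `slotC_eq_laPt`, `slotH_eq_laPt` — the models through their codes; `dist_laPt_sq` — squared distances are
  `a'² Q/9 + (Δ height)²` with the integer form `Q = Δx² + Δx Δy + Δy²` (`laQn`);
* `stub_exactBand` (anchor) — at a site of a set with the gap clause whose bond shell is an exact slot model,
  the in-plane spacing and both interlayer bond lengths lie in the radial band `[0.98a, 1.02a]`;
* THE ATLAS `la_dist_le_iff_adj` — in that band (hypothesis bundle `hb`) two distinct slots are within bond range `1.02a` of each other
  iff they are polytope-adjacent (`laAdj`: same level with `Q = 9`, or adjacent levels with `Q = 3`), and then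
  their distance is `a'` or an interlayer bond length (`la_dist_of_adj`); the radii by level (`la_norm_code`).
-/

noncomputable section

namespace Summit.AtomisticToContinuum.Crystallization.Theorems.CleanHull

open Literature.MathematicalPhysics.StatisticalMechanics

/-! ## Codes -/

/-- Integer codes `(3x, 3y, level)` of the cubic slot model, in the order of `slotC`. [folklore] -/
def laCodeC : Fin 12 → ℤ × ℤ × ℤ :=
  ![(3, 0, 0), (-3, 0, 0), (0, 3, 0), (0, -3, 0), (3, -3, 0), (-3, 3, 0),
    (1, 1, 1), (-2, 1, 1), (1, -2, 1), (-1, -1, -1), (2, -1, -1), (-1, 2, -1)]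

/-- Integer codes of the hexagonal slot model, in the order of `slotH`. [folklore] -/
def laCodeH : Fin 12 → ℤ × ℤ × ℤ :=
  ![(3, 0, 0), (-3, 0, 0), (0, 3, 0), (0, -3, 0), (3, -3, 0), (-3, 3, 0),
    (1, 1, 1), (-2, 1, 1), (1, -2, 1), (1, 1, -1), (-2, 1, -1), (1, -2, -1)]

/-- The codes of the model of type `t` (`true` = cubic, `false` = hexagonal). [folklore] -/
def laCode (t : Bool) : Fin 12 → ℤ × ℤ × ℤ := if t then laCodeC else laCodeH

/-- The slot model of type `t`. [folklore] -/
def laSlot (t : Bool) (a' kp km : ℝ) : Fin 12 → EuclideanSpace ℝ (Fin 3) := if t then slotC a' kp km else slotH a' kp km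

/-- The height of a level: `0 ↦ 0`, `1 ↦ h⁺`, `-1 ↦ -h⁻`. [folklore] -/
def laHt (kp km : ℝ) (l : ℤ) : ℝ := if l = 1 then kp else if l = -1 then -km else 0

/-- The point with code `c`: `(c₁/3) u + (c₂/3) v + height(c₃) e₃`. [folklore] -/
def laPt (a' kp km : ℝ) (c : ℤ × ℤ × ℤ) : EuclideanSpace ℝ (Fin 3) :=
  ((c.1 : ℝ) / 3) • triangularVec₁ a' + ((c.2.1 : ℝ) / 3) • triangularVec₂ a' + laHt kp km c.2.2 • layerNormal 1

/-- The integer in-plane form of the difference of two codes. [folklore] -/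
def laQn (c d : ℤ × ℤ × ℤ) : ℤ :=
  (c.1 - d.1) ^ 2 + (c.1 - d.1) * (c.2.1 - d.2.1) + (c.2.1 - d.2.1) ^ 2

/-- Polytope adjacency of two codes: same level and `Q = 9` (in-plane / cap edges), or levels `0` and `±1`
with `Q = 3` (interlayer edges). [folklore] -/
def laAdj (c d : ℤ × ℤ × ℤ) : Bool :=
  if c.2.2 = d.2.2 then laQn c d == 9 else if c.2.2 = 0 ∨ d.2.2 = 0 then laQn c d == 3 else false

/-! ## The models through their codes -/

/-- `slotC` through its codes. [folklore] -/
theorem slotC_eq_laPt (a' kp km : ℝ) (i : Fin 12) : slotC a' kp km i = laPt a' kp km (laCodeC i) := by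
  ext l
  fin_cases i <;> fin_cases l <;>
    simp [slotC, laPt, laCodeC, laHt, triangularVec₁, triangularVec₂, barlowOffset, layerNormal] <;> ring

/-- `slotH` through its codes. [folklore] -/
theorem slotH_eq_laPt (a' kp km : ℝ) (i : Fin 12) : slotH a' kp km i = laPt a' kp km (laCodeH i) := by
  ext l
  fin_cases i <;> fin_cases l <;>
    simp [slotH, laPt, laCodeH, laHt, triangularVec₁, triangularVec₂, barlowOffset, layerNormal] <;> ring

/-- Either model through its codes. [folklore] -/
theorem laSlot_eq_laPt (t : Bool) (a' kp km : ℝ) (i : Fin 12) :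
    laSlot t a' kp km i = laPt a' kp km (laCode t i) := by
  cases t
  · exact slotH_eq_laPt a' kp km i
  · exact slotC_eq_laPt a' kp km i

/-! ## Norms and distances -/

/-- `‖x u + y v + t e₃‖² = a'² (x² + x y + y²) + t²`. [folklore] -/
theorem la_norm_sq (a' x y t : ℝ) :
    ‖x • triangularVec₁ a' + y • triangularVec₂ a' + t • layerNormal 1‖ ^ 2 =
      a' ^ 2 * (x ^ 2 + x * y + y ^ 2) + t ^ 2 := by
  rw [EuclideanSpace.norm_sq_eq, Fin.sum_univ_three]
  simp only [PiLp.add_apply, PiLp.smul_apply, triangularVec₁, triangularVec₂, layerNormal, smul_eq_mul,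
    Real.norm_eq_abs, sq_abs]
  simp
  have h3 : Real.sqrt 3 ^ 2 = 3 := Real.sq_sqrt (by norm_num)
  linear_combination (a' ^ 2 * y ^ 2 / 4) * h3

/-- `⟪x u + y v + t e₃, e₃⟫ = t`. [folklore] -/
theorem la_inner_layerNormal (a' x y t : ℝ) :
    inner ℝ (x • triangularVec₁ a' + y • triangularVec₂ a' + t • layerNormal 1) (layerNormal (1 : ℝ)) = t := by
  simp [EuclideanSpace.inner_eq_star_dotProduct, triangularVec₁, triangularVec₂, layerNormal,
    dotProduct, Fin.sum_univ_three]

/-- Differences of code points. [folklore] -/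
theorem laPt_sub (a' kp km : ℝ) (c d : ℤ × ℤ × ℤ) :
    laPt a' kp km c - laPt a' kp km d =
      (((c.1 - d.1 : ℤ) : ℝ) / 3) • triangularVec₁ a' + (((c.2.1 - d.2.1 : ℤ) : ℝ) / 3) • triangularVec₂ a' +
        (laHt kp km c.2.2 - laHt kp km d.2.2) • layerNormal 1 := by
  simp only [laPt, Int.cast_sub]
  module

/-- **Squared distances of code points**: `a'² Q/9 + (Δ height)²`. [folklore] -/
theorem dist_laPt_sq (a' kp km : ℝ) (c d : ℤ × ℤ × ℤ) :
    dist (laPt a' kp km c) (laPt a' kp km d) ^ 2 =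
      a' ^ 2 * (laQn c d : ℝ) / 9 + (laHt kp km c.2.2 - laHt kp km d.2.2) ^ 2 := by
  rw [dist_eq_norm, laPt_sub, la_norm_sq]
  push_cast [laQn]
  ring

/-- Squared norms of code points. [folklore] -/
theorem norm_laPt_sq (a' kp km : ℝ) (c : ℤ × ℤ × ℤ) :
    ‖laPt a' kp km c‖ ^ 2 =
      a' ^ 2 * ((c.1 : ℝ) ^ 2 + c.1 * c.2.1 + (c.2.1 : ℝ) ^ 2) / 9 + laHt kp km c.2.2 ^ 2 := by
  rw [laPt, la_norm_sq]
  ring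

/-- The height of a code point. [folklore] -/
theorem inner_laPt_layerNormal (a' kp km : ℝ) (c : ℤ × ℤ × ℤ) :
    inner ℝ (laPt a' kp km c) (layerNormal (1 : ℝ)) = laHt kp km c.2.2 := by
  rw [laPt, la_inner_layerNormal]

/-! ## Combinatorics of the codes (`decide`) -/

/-- Levels and in-plane forms of the codes: level `0` with `Q = 9`, or level `±1` with `Q = 3`. [folklore] -/
theorem laCode_level (t : Bool) (i : Fin 12) :
    ((laCode t i).2.2 = 0 ∧ (laCode t i).1 ^ 2 + (laCode t i).1 * (laCode t i).2.1 + (laCode t i).2.1 ^ 2 = 9) ∨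
    ((laCode t i).2.2 = 1 ∧ (laCode t i).1 ^ 2 + (laCode t i).1 * (laCode t i).2.1 + (laCode t i).2.1 ^ 2 = 3) ∨
    ((laCode t i).2.2 = -1 ∧ (laCode t i).1 ^ 2 + (laCode t i).1 * (laCode t i).2.1 + (laCode t i).2.1 ^ 2 = 3) := by
  revert t i
  decide

/-- Distinct non-adjacent codes: same level with `Q ≥ 27`, or adjacent levels with `Q ≥ 12`, or opposite
levels. [folklore] -/
theorem laCode_nonadj (t : Bool) (i j : Fin 12) (hij : i ≠ j) (h : laAdj (laCode t i) (laCode t j) = false) :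
    ((laCode t i).2.2 = (laCode t j).2.2 ∧ 27 ≤ laQn (laCode t i) (laCode t j)) ∨
    (((laCode t i).2.2 = 0 ∨ (laCode t j).2.2 = 0) ∧ (laCode t i).2.2 ≠ (laCode t j).2.2 ∧
      12 ≤ laQn (laCode t i) (laCode t j)) ∨
    ((laCode t i).2.2 = 1 ∧ (laCode t j).2.2 = -1) ∨ ((laCode t i).2.2 = -1 ∧ (laCode t j).2.2 = 1) := by
  revert h hij i j t
  decide

/-- Distinct codes are distinct. [folklore] -/
theorem laCode_injective (t : Bool) : Function.Injective (laCode t) := by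
  intro i j h
  revert h i j t
  decide

/-- Unfolding adjacency. [folklore] -/
theorem laAdj_iff (c d : ℤ × ℤ × ℤ) : laAdj c d = true ↔
    (c.2.2 = d.2.2 ∧ laQn c d = 9) ∨ (c.2.2 ≠ d.2.2 ∧ (c.2.2 = 0 ∨ d.2.2 = 0) ∧ laQn c d = 3) := by
  unfold laAdj
  split_ifs with h1 h2 <;> simp_all

/-! ## The radial band -/

/-- **Anchor: the radial band at an exact site.** If the bond shell of a point `p` of a set with the gap clause
at scale `a` is an exact slot model (either type) with spacing `a' > 0` and heights `h⁺, h⁻ > 0`, then `a'` and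
both interlayer bond lengths `√(a'²/3 + h±²)` lie in `[a(1 - 1/50), a(1 + 1/50)]`. [folklore] -/
theorem stub_exactBand (Z : Set (EuclideanSpace ℝ (Fin 3))) (a : ℝ) (ha : 0 < a)
    (hgap : ∀ y ∈ Z, ∀ w ∈ Z, w ≠ y → a * (1 - 1 / 50) ≤ dist y w ∧
      (dist y w ≤ a * (1 + 1 / 50) ∨ a * (63 / 50) ≤ dist y w))
    (p : EuclideanSpace ℝ (Fin 3)) (hp : p ∈ Z) (a' hp' hm' : ℝ)
    (A : EuclideanSpace ℝ (Fin 3) →ₗᵢ[ℝ] EuclideanSpace ℝ (Fin 3)) (ha' : 0 < a') (hhp : 0 < hp') (hhm : 0 < hm')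
    (hS : (bondShell a Z p = Set.range fun k : Fin 12 => p + A (slotC a' hp' hm' k)) ∨
      (bondShell a Z p = Set.range fun k : Fin 12 => p + A (slotH a' hp' hm' k))) :
    a * (1 - 1 / 50) ≤ a' ∧ a' ≤ a * (1 + 1 / 50) ∧
      (a * (1 - 1 / 50)) ^ 2 ≤ a' ^ 2 / 3 + hp' ^ 2 ∧ a' ^ 2 / 3 + hp' ^ 2 ≤ (a * (1 + 1 / 50)) ^ 2 ∧
      (a * (1 - 1 / 50)) ^ 2 ≤ a' ^ 2 / 3 + hm' ^ 2 ∧ a' ^ 2 / 3 + hm' ^ 2 ≤ (a * (1 + 1 / 50)) ^ 2 := by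
  have _ := ha; have _ := hp; have _ := hhp; have _ := hhm
  -- the norm of a slot is the distance of the corresponding shell point from `p`, hence in the band
  have key : ∀ slot : Fin 12 → EuclideanSpace ℝ (Fin 3), (bondShell a Z p = Set.range fun k : Fin 12 => p + A (slot k)) →
      ∀ k, a * (1 - 1 / 50) ≤ ‖slot k‖ ∧ ‖slot k‖ ≤ a * (1 + 1 / 50) := by
    intro slot h k
    have hk : p + A (slot k) ∈ bondShell a Z p := by rw [h]; exact ⟨k, rfl⟩
    obtain ⟨hZ, hne, hle⟩ := hk
    have hd : dist p (p + A (slot k)) = ‖slot k‖ := by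
      rw [dist_comm, dist_eq_norm, add_sub_cancel_left, A.norm_map]
    exact ⟨hd ▸ (hgap p hp _ hZ hne).1, hd ▸ hle⟩
  have h098 : 0 ≤ a * (1 - 1 / 50) := by positivity
  have sq_le : ∀ {r s : ℝ}, 0 ≤ r → r ≤ s → r ^ 2 ≤ s ^ 2 := fun hr h => pow_le_pow_left₀ hr h 2
  rcases hS with h | h
  · have b := key _ h
    have n0 : ‖slotC a' hp' hm' 0‖ = a' := by rw [norm_slotC_zero, abs_of_pos ha']
    have n6 := norm_sq_slotC_six a' hp' hm'
    have n9 := norm_sq_slotC_nine a' hp' hm'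
    refine ⟨n0 ▸ (b 0).1, n0 ▸ (b 0).2, ?_, ?_, ?_, ?_⟩
    · have := sq_le h098 (b 6).1; rw [n6] at this; linarith
    · have := sq_le (norm_nonneg _) (b 6).2; rw [n6] at this; linarith
    · have := sq_le h098 (b 9).1; rw [n9] at this; linarith
    · have := sq_le (norm_nonneg _) (b 9).2; rw [n9] at this; linarith
  · have b := key _ h
    obtain ⟨e0, -, e6⟩ := slotH_eq_slotC_of a' hp' hm'
    have n0 : ‖slotH a' hp' hm' 0‖ = a' := by rw [e0, norm_slotC_zero, abs_of_pos ha']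
    have n6 : ‖slotH a' hp' hm' 6‖ ^ 2 = hp' ^ 2 + a' ^ 2 / 3 := by rw [e6]; exact norm_sq_slotC_six a' hp' hm'
    have n9 := norm_sq_slotH_nine a' hp' hm'
    refine ⟨n0 ▸ (b 0).1, n0 ▸ (b 0).2, ?_, ?_, ?_, ?_⟩
    · have := sq_le h098 (b 6).1; rw [n6] at this; linarith
    · have := sq_le (norm_nonneg _) (b 6).2; rw [n6] at this; linarith
    · have := sq_le h098 (b 9).1; rw [n9] at this; linarith
    · have := sq_le (norm_nonneg _) (b 9).2; rw [n9] at this; linarith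

/-! ## The atlas: bond range ⟺ adjacency -/

section Atlas

variable {a a' kp km : ℝ}

/-- Heights of the three levels. [folklore] -/
theorem laHt_values (kp km : ℝ) : laHt kp km 0 = 0 ∧ laHt kp km 1 = kp ∧ laHt kp km (-1) = -km := by
  simp [laHt]

/-- **Radii by level**: a level-`0` slot has norm `a'`, a level-`±1` slot has squared norm `a'²/3 + h±²`.
[folklore] -/
theorem la_norm_code (ha' : 0 < a') (t : Bool) (i : Fin 12) :
    ((laCode t i).2.2 = 0 ∧ ‖laPt a' kp km (laCode t i)‖ = a') ∨
    ((laCode t i).2.2 = 1 ∧ ‖laPt a' kp km (laCode t i)‖ ^ 2 = a' ^ 2 / 3 + kp ^ 2) ∨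
    ((laCode t i).2.2 = -1 ∧ ‖laPt a' kp km (laCode t i)‖ ^ 2 = a' ^ 2 / 3 + km ^ 2) := by
  have hn := norm_laPt_sq a' kp km (laCode t i)
  rcases laCode_level t i with ⟨hl, hq⟩ | ⟨hl, hq⟩ | ⟨hl, hq⟩
  · refine Or.inl ⟨hl, ?_⟩
    have hq' : ((laCode t i).1 : ℝ) ^ 2 + (laCode t i).1 * (laCode t i).2.1 + ((laCode t i).2.1 : ℝ) ^ 2 = 9 := by
      exact_mod_cast hq
    rw [hq', hl, (laHt_values kp km).1] at hn
    have : ‖laPt a' kp km (laCode t i)‖ ^ 2 = a' ^ 2 := by rw [hn]; ring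
    exact (pow_left_inj₀ (norm_nonneg _) ha'.le two_ne_zero).1 this
  · refine Or.inr (Or.inl ⟨hl, ?_⟩)
    have hq' : ((laCode t i).1 : ℝ) ^ 2 + (laCode t i).1 * (laCode t i).2.1 + ((laCode t i).2.1 : ℝ) ^ 2 = 3 := by
      exact_mod_cast hq
    rw [hq', hl, (laHt_values kp km).2.1] at hn
    rw [hn]; ring
  · refine Or.inr (Or.inr ⟨hl, ?_⟩)
    have hq' : ((laCode t i).1 : ℝ) ^ 2 + (laCode t i).1 * (laCode t i).2.1 + ((laCode t i).2.1 : ℝ) ^ 2 = 3 := by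
      exact_mod_cast hq
    rw [hq', hl, (laHt_values kp km).2.2] at hn
    rw [hn]; ring

/-- **Edge lengths**: adjacent slots are at distance `a'` (same level) or at an interlayer bond length.
[folklore] -/
theorem la_dist_of_adj (ha' : 0 < a') {c d : ℤ × ℤ × ℤ} (hc : c.2.2 = 0 ∨ c.2.2 = 1 ∨ c.2.2 = -1)
    (hd : d.2.2 = 0 ∨ d.2.2 = 1 ∨ d.2.2 = -1) (h : laAdj c d = true) :
    (c.2.2 = d.2.2 ∧ dist (laPt a' kp km c) (laPt a' kp km d) = a') ∨
    (c.2.2 ≠ d.2.2 ∧ (c.2.2 = 1 ∨ d.2.2 = 1) ∧ dist (laPt a' kp km c) (laPt a' kp km d) ^ 2 = a' ^ 2 / 3 + kp ^ 2) ∨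
    (c.2.2 ≠ d.2.2 ∧ (c.2.2 = -1 ∨ d.2.2 = -1) ∧ dist (laPt a' kp km c) (laPt a' kp km d) ^ 2 = a' ^ 2 / 3 + km ^ 2) := by
  have hD := dist_laPt_sq a' kp km c d
  obtain ⟨h0, h1, h2⟩ := laHt_values kp km
  rcases (laAdj_iff c d).1 h with ⟨hl, hq⟩ | ⟨hl, h0', hq⟩
  · refine Or.inl ⟨hl, ?_⟩
    rw [hq, hl, sub_self] at hD
    have : dist (laPt a' kp km c) (laPt a' kp km d) ^ 2 = a' ^ 2 := by rw [hD]; push_cast; ring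
    exact (pow_left_inj₀ dist_nonneg ha'.le two_ne_zero).1 this
  · rw [hq] at hD
    push_cast at hD
    rcases h0' with hc0 | hd0
    · rw [hc0] at hl hD ⊢
      rcases hd with hd' | hd' | hd' <;> rw [hd'] at hl hD ⊢
      · exact absurd rfl hl
      · right; left; refine ⟨by decide, Or.inr rfl, ?_⟩; rw [hD, h0, h1]; ring
      · right; right; refine ⟨by decide, Or.inr rfl, ?_⟩; rw [hD, h0, h2]; ring
    · rw [hd0] at hl hD ⊢
      rcases hc with hc' | hc' | hc' <;> rw [hc'] at hl hD ⊢
      · exact absurd rfl hl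
      · right; left; refine ⟨by decide, Or.inl rfl, ?_⟩; rw [hD, h0, h1]; ring
      · right; right; refine ⟨by decide, Or.inl rfl, ?_⟩; rw [hD, h0, h2]; ring

/-- Adjacent slots are within bond range (band). [folklore] -/
theorem la_dist_le_of_adj (hb : 0 < a ∧ 0 < kp ∧ 0 < km ∧ a * (1 - 1 / 50) ≤ a' ∧ a' ≤ a * (1 + 1 / 50) ∧
      (a * (1 - 1 / 50)) ^ 2 ≤ a' ^ 2 / 3 + kp ^ 2 ∧ a' ^ 2 / 3 + kp ^ 2 ≤ (a * (1 + 1 / 50)) ^ 2 ∧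
      (a * (1 - 1 / 50)) ^ 2 ≤ a' ^ 2 / 3 + km ^ 2 ∧ a' ^ 2 / 3 + km ^ 2 ≤ (a * (1 + 1 / 50)) ^ 2) (t : Bool) (i j : Fin 12)
    (h : laAdj (laCode t i) (laCode t j) = true) :
    dist (laPt a' kp km (laCode t i)) (laPt a' kp km (laCode t j)) ≤ a * (1 + 1 / 50) := by
  obtain ⟨ha, hkp, hkm, hlo, hhi, hplo, hphi, hmlo, hmhi⟩ := hb
  have ha' : 0 < a' := by linarith
  have lv : ∀ k, (laCode t k).2.2 = 0 ∨ (laCode t k).2.2 = 1 ∨ (laCode t k).2.2 = -1 := fun k => by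
    rcases laCode_level t k with h | h | h
    · exact Or.inl h.1
    · exact Or.inr (Or.inl h.1)
    · exact Or.inr (Or.inr h.1)
  have h102 : 0 ≤ a * (1 + 1 / 50) := by positivity
  rcases la_dist_of_adj (kp := kp) (km := km) ha' (lv i) (lv j) h with ⟨-, hd⟩ | ⟨-, -, hd⟩ | ⟨-, -, hd⟩
  · rw [hd]; exact hhi
  · exact (pow_le_pow_iff_left₀ dist_nonneg h102 two_ne_zero).1 (by rw [hd]; exact hphi)
  · exact (pow_le_pow_iff_left₀ dist_nonneg h102 two_ne_zero).1 (by rw [hd]; exact hmhi)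

/-- Non-adjacent distinct slots are beyond bond range (band). [folklore] -/
theorem la_lt_dist_of_not_adj (hb : 0 < a ∧ 0 < kp ∧ 0 < km ∧ a * (1 - 1 / 50) ≤ a' ∧ a' ≤ a * (1 + 1 / 50) ∧
      (a * (1 - 1 / 50)) ^ 2 ≤ a' ^ 2 / 3 + kp ^ 2 ∧ a' ^ 2 / 3 + kp ^ 2 ≤ (a * (1 + 1 / 50)) ^ 2 ∧
      (a * (1 - 1 / 50)) ^ 2 ≤ a' ^ 2 / 3 + km ^ 2 ∧ a' ^ 2 / 3 + km ^ 2 ≤ (a * (1 + 1 / 50)) ^ 2) (t : Bool) (i j : Fin 12) (hij : i ≠ j)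
    (h : laAdj (laCode t i) (laCode t j) = false) :
    a * (1 + 1 / 50) < dist (laPt a' kp km (laCode t i)) (laPt a' kp km (laCode t j)) := by
  obtain ⟨ha, hkp, hkm, hlo, hhi, hplo, hphi, hmlo, hmhi⟩ := hb
  have h102 : 0 ≤ a * (1 + 1 / 50) := by positivity
  rw [← pow_lt_pow_iff_left₀ h102 dist_nonneg two_ne_zero, dist_laPt_sq]
  obtain ⟨h0, h1, h2⟩ := laHt_values kp km
  have hkp2 : (39 / 50 * a) ^ 2 ≤ kp ^ 2 := by nlinarith
  have hkm2 : (39 / 50 * a) ^ 2 ≤ km ^ 2 := by nlinarith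
  have hkp' : 39 / 50 * a ≤ kp := (pow_le_pow_iff_left₀ (by positivity) hkp.le two_ne_zero).1 hkp2
  have hkm' : 39 / 50 * a ≤ km := (pow_le_pow_iff_left₀ (by positivity) hkm.le two_ne_zero).1 hkm2
  rcases laCode_nonadj t i j hij h with ⟨hl, hq⟩ | ⟨h0', hl, hq⟩ | ⟨hc, hd⟩ | ⟨hc, hd⟩
  · rw [hl, sub_self]
    have hq' : (27 : ℝ) ≤ laQn (laCode t i) (laCode t j) := by exact_mod_cast hq
    nlinarith
  · have hq' : (12 : ℝ) ≤ laQn (laCode t i) (laCode t j) := by exact_mod_cast hq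
    nlinarith [sq_nonneg (laHt kp km (laCode t i).2.2 - laHt kp km (laCode t j).2.2)]
  · rw [hc, hd, h1, h2]
    have hq' : (0 : ℝ) ≤ laQn (laCode t i) (laCode t j) := by
      have : 0 ≤ laQn (laCode t i) (laCode t j) := by
        unfold laQn; nlinarith [sq_nonneg ((laCode t i).1 - (laCode t j).1 + ((laCode t i).2.1 - (laCode t j).2.1)),
          sq_nonneg ((laCode t i).1 - (laCode t j).1), sq_nonneg ((laCode t i).2.1 - (laCode t j).2.1)]
      exact_mod_cast this
    nlinarith
  · rw [hc, hd, h1, h2]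
    have hq' : (0 : ℝ) ≤ laQn (laCode t i) (laCode t j) := by
      have : 0 ≤ laQn (laCode t i) (laCode t j) := by
        unfold laQn; nlinarith [sq_nonneg ((laCode t i).1 - (laCode t j).1 + ((laCode t i).2.1 - (laCode t j).2.1)),
          sq_nonneg ((laCode t i).1 - (laCode t j).1), sq_nonneg ((laCode t i).2.1 - (laCode t j).2.1)]
      exact_mod_cast this
    nlinarith

/-- **The atlas.** In the band, two distinct slots of one model are within bond range `a(1 + 1/50)` of each
other iff they are polytope-adjacent. [folklore] -/
theorem la_dist_le_iff_adj (hb : 0 < a ∧ 0 < kp ∧ 0 < km ∧ a * (1 - 1 / 50) ≤ a' ∧ a' ≤ a * (1 + 1 / 50) ∧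
      (a * (1 - 1 / 50)) ^ 2 ≤ a' ^ 2 / 3 + kp ^ 2 ∧ a' ^ 2 / 3 + kp ^ 2 ≤ (a * (1 + 1 / 50)) ^ 2 ∧
      (a * (1 - 1 / 50)) ^ 2 ≤ a' ^ 2 / 3 + km ^ 2 ∧ a' ^ 2 / 3 + km ^ 2 ≤ (a * (1 + 1 / 50)) ^ 2) (t : Bool) (i j : Fin 12) (hij : i ≠ j) :
    dist (laPt a' kp km (laCode t i)) (laPt a' kp km (laCode t j)) ≤ a * (1 + 1 / 50) ↔
      laAdj (laCode t i) (laCode t j) = true := by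
  constructor
  · intro h
    by_contra hna
    exact absurd h (not_le.2 (la_lt_dist_of_not_adj hb t i j hij (Bool.eq_false_iff.2 hna)))
  · exact la_dist_le_of_adj hb t i j

end Atlas

end Summit.AtomisticToContinuum.Crystallization.Theorems.CleanHull

end
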